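import Summits.Langlands.Langlands.Theorems.PicardMuOrdinaryMuOrdinaryFamilyRTCharZeroReduction
import Literature.NumberTheory.GaloisRepresentations.OrdinaryRegular
import Literature.NumberTheory.GaloisRepresentations.LocalClassFieldTheory
import Summits.Langlands.Langlands.Theorems.MuOrdinaryFamilyRT.Negative.AccumulationDominance
import Summits.Langlands.Langlands.Theorems.MuOrdinaryFamilyRT.Negative.AccumulationNormality
import Summits.Langlands.Langlands.Theorems.MuOrdinaryFamilyRT.Negative.ScopeVacuity
import Summits.Langlands.Langlands.Theorems.MuOrdinaryFamilyRT.Negative.ConjSelfDualShadow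
import Summits.Langlands.Langlands.Theorems.MuOrdinaryFamilyRT.Negative.CongruenceEncoding
import HarnessLib

/-!
# Crux `MuOrdinaryFamilyRT` (stmt-Langlands-13757), line `thorne-minimal-lift`: the typed vocabulary and the
# statements of the six registered stubs (Defs file)

This file LANDS, verbatim from the registered skeleton `Cruxes/MuOrdinaryFamilyRT/Lines/thorne_minimal_lift.lean`
(crux-strategist planner-cstrat-stmt-Langlands-13757-p1-0, 2026-08-17; lead prover-line-stmt-Langlands-13757-c3-0;
registration f4aa57de), the line's typed notions and the STATEMENTS of its stubs, so that (i) stub-workers and the lead can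
land proofs of the registered stubs `stub_X : T.stub_X` against importable statements, (ii) the reduction
"`MuOrdinaryFamilyRT` ⇐ the six stubs" can be kernel-checked in the tree (companion `…ThorneReduction.lean`), and (iii) the
tenure planner can split the crux along `MainClassPlus` citing tree declarations (STRATEGY-CENSUS.md §4).

* § 1 the scope `PotUnramifiedAway S₀ ρ`, `MainClassPlus f S₀ ρ_C` (char-zero's `MainClass` + potentially good reduction away
  from `3`);
* § 2 `pointRep 𝓕 y` (the representation at a `ℚ̄₃`-point of an `OrdFamily`), `PotUnramifiedFamily 𝓕` (minimality of the
  family away from `3`), `HasOrdinaryCompanion 𝓕 F' hcpt' S' y` (hypothesis (iv) of Thorne 2017 Thm 5.1 for `ρ_y|Γ_{F'}` in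
  ordinary same-weight form), `IsClassicalOver 𝓕 F' hcpt' S' y` (the per-point classicality clause of char-zero's K1);
* § 3 the statements `T.stub_minimalFamily` (K2⁺), `T.stub_finiteOverWeights`, `T.stub_companions`, `T.stub_thorneLift`,
  `T.stub_definiteHostPlus` (K1⁺, DERIVED in `…ThorneReduction`), `T.stub_remainderPlus` (conceded complement),
  `T.stub_facts` (Literature debts).

Everything here is a definition or a statement; nothing is proved.  The vocabulary it builds on (`K`, `Generic`,
`PicardInput`, `MainClass`, `IsMuOrdinaryAtThree`, `OrdFamily`, `rbar`, `IsUpper3`, `S.stub_*`) is the landed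
`…CharZeroDefs` (p111741) of line char-zero-dominance.  Sources, intended witnesses and why-it-might-fail of every notion
are in the docstrings (Thorne Math. Z. 285 (2017) Thm 5.1 / Prop 2.21 / Def 2.20 / Thm 4.2; Guralnick–Herzig–Tiep JEMS 19
(2017) Thm 1.7; BLGGT Ann. Math. 179 (2014) Lemmas 1.2.3, 1.4.3, 2.2.2, §2.1; Geraghty Math. Ann. 373 (2019) §§2–5;
CHT 2008 Lemma 4.1.2; Kisin 2008 §2.3; Allen arXiv:1411.7661) and in `Lines/thorne-minimal-lift.md` / `STRATEGY-CENSUS.md`.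
-/

set_option linter.dupNamespace false

namespace Summit.Langlands.Langlands.Cruxes.MuOrdinaryFamilyRT.ThorneMinimalLift

open scoped NumberField Polynomial Matrix Classical
open Field IsDedekindDomain Polynomial
open Literature.NumberTheory.GaloisRepresentations Literature.NumberTheory.Automorphic
open Summit.Langlands.Langlands.Cruxes.MuOrdinaryFamilyRT.CharZeroDominance

noncomputable section

/-! ## 1. Scope: the main class of char-zero-dominance, made MINIMAL away from `3` -/

/-- **`ρ` is potentially unramified at the places of `S₀` away from `3`** (finite image of inertia: the
Jacobian of the Picard curve has potentially GOOD reduction at every bad prime `v ∤ 3`; e.g. `disc f`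
squarefree away from `6`, BBW 2017 Thm 4(b)).  Needed so that the minimal family of `stub_minimalFamily`
exists (purity at `v` ⇒ `x_C` is a smooth point of the local lifting space ⇒ `N = 0` along the whole
irreducible family) and so that a soluble base change makes the points of the family AND their companions
unramified at `v`, where Thorne's hypothesis (iv)(b) is then automatic. -/
def PotUnramifiedAway (S₀ : Finset (HeightOneSpectrum (𝓞 K)))
    (ρ : FramedGaloisRep K (PadicAlgCl 3) 3) : Prop :=
  ∀ v ∈ S₀, ((3 : ℕ) : 𝓞 K) ∉ v.asIdeal →
    ∃ U : OpenSubgroup (absoluteGaloisGroup (v.adicCompletion K)),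
      ∀ τ ∈ absInertia (v.adicCompletion K), τ ∈ U → ρ (absGaloisRestrict K (v.adicCompletion K) τ) = 1

/-- **The main class of this line**: `MainClass f ρ_C` of char-zero-dominance (`ρ_C` μ-ordinary at `3`,
image `S₄`) AND potentially good reduction away from `3`. -/
def MainClassPlus (f : ℤ[X]) (S₀ : Finset (HeightOneSpectrum (𝓞 K)))
    (ρC : FramedGaloisRep K (PadicAlgCl 3) 3) : Prop :=
  MainClass f ρC ∧ PotUnramifiedAway S₀ ρC

/-! ## 2. Points of a family and their ordinary automorphic companions over `F'` -/

variable {f : ℤ[X]} {ι : PadicAlgCl 3 ≃+* ℂ} {e : K →+* ℂ} {S₀ : Finset (HeightOneSpectrum (𝓞 K))}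
  {ρC : FramedGaloisRep K (PadicAlgCl 3) 3}

/-- The `ℚ̄₃`-valued representation `ρ_y = y ∘ ρ` at a `ℚ̄₃`-point `y` of the family (a bare homomorphism;
its continuity / packaging as a `FramedGaloisRep` is part of `stub_thorneLift`). -/
def pointRep (𝓕 : OrdFamily f ι e S₀ ρC) (y : 𝓕.R →+* PadicAlgCl 3) :
    absoluteGaloisGroup K →* GL (Fin 3) (PadicAlgCl 3) :=
  (Matrix.GeneralLinearGroup.map y).comp 𝓕.ρ

/-- **The family is minimal away from `3`**: at every `v ∈ S₀`, `v ∤ 3`, an open subgroup of inertia acts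
trivially through `𝓕.ρ` ITSELF (uniformly in the point).  Intended witness: the irreducible component through
`x_C` of Geraghty's flag scheme over the minimal (fixed inertial type, `N = 0`) polarized `S₀`-ramified
deformation ring; `N = 0` along the component because `ρ_C` is pure of weight `1` at `v` (no Frobenius
eigenvalues of ratio `N v`). -/
def PotUnramifiedFamily (𝓕 : OrdFamily f ι e S₀ ρC) : Prop :=
  ∀ v ∈ S₀, ((3 : ℕ) : 𝓞 K) ∉ v.asIdeal →
    ∃ U : OpenSubgroup (absoluteGaloisGroup (v.adicCompletion K)),
      ∀ τ ∈ absInertia (v.adicCompletion K), τ ∈ U → 𝓕.ρ (absGaloisRestrict K (v.adicCompletion K) τ) = 1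

/-- **`HasOrdinaryCompanion 𝓕 F' hcpt' S' y`** — hypothesis (iv) of Thorne's Thm 5.1 for `ρ_y|Γ_{F'}`, in the
ordinary same-weight form in which "`r_ι(π)|G_{F'_w} ∼ ρ_y|G_{F'_w}`" holds at `w ∣ 3` by potential
diagonalizability (BLGGT Lemma 1.4.3(1)) and at `w ∤ 3` after a soluble base change killing both (finite) inertial
images: there are a regular algebraic cuspidal `P^c` on `GL₃(𝔸_{F'})` and a framed `r^c : Γ_{F'} → GL₃(ℚ̄₃)` with
(a) `r^c` attached to `P^c` at the unramified places prime to `3` (lang.S27 compatibility, tree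
`IsGaloisCompatibleAt`); (b) `r^c` POLARIZED in trace form with the family's exponent `𝓕.m`
(`tr r^c(c σ c⁻¹) = ε(σ)^m tr r^c(σ⁻¹)` for the complex conjugations `c ∈ Γ_ℚ`; `F'/ℚ` is Galois); (c) `r^c`
potentially unramified at `w ∈ S'`, `w ∤ 3`; (d) `r^c ≡ ρ_y|Γ_{F'}` residually (entrywise, in a common integral
frame); (e) at every `w ∣ 3`, for the canonical local Artin datum, a DOMINANT labelled weight `λ_w` with gaps `≥ 2`
such that `r^c` is ordinary of weight `λ_w` at `w` (tree `IsOrdinaryOfLabelledWeightAt`, = BLGGT §1.4 / Geraghty)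
AND `ρ_y|Γ_{F'_w}` is Borel with the SAME diagonal inertial characters `∏_τ τ(Art⁻¹ ·)^{-(λ_{τ,3-i}+i-1)}` on an
open subgroup of inertia.  Intended witness: the weight-`κ(y)` member of the ordinary Hida family, on the definite
unitary group `U(3)_{F'/F'⁺}` (`F' = K(√d)`, `d > 0`, `3` split in `F'/F'⁺`, `F'_w = K_λ`), through the base
change of the free `S₄ ≅ PGL₂(𝔽₃)` seed. -/
def HasOrdinaryCompanion (𝓕 : OrdFamily f ι e S₀ ρC)
    (F' : Type) [Field F'] [NumberField F'] [Algebra K F'] [IsGalois ℚ F']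
    (hcpt' : isCompact_glFiniteIntegralLevel 3 F') (S' : Finset (HeightOneSpectrum (𝓞 F')))
    (y : 𝓕.R →+* PadicAlgCl 3) : Prop :=
  ∃ (Pc : CuspidalAutomorphicRepData 3 F' hcpt') (rc : FramedGaloisRep F' (PadicAlgCl 3) 3),
    Pc.1.IsRegularAlgebraic ∧
    -- (a) attached to `P^c` off `S'` and `3`
    (∀ w : HeightOneSpectrum (𝓞 F'), w ∉ S' → ((3 : ℕ) : 𝓞 F') ∉ w.asIdeal →
      IsGaloisCompatibleAt Pc.1 ι rc w) ∧
    -- (b) polarized in trace form with the family's exponent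
    (∀ c : absoluteGaloisGroup ℚ, IsComplexConjugation (algebraMap ℚ ℝ) c →
      ∀ σ : absoluteGaloisGroup F', FramedRep.trace rc (absGaloisOuterConj ℚ F' c σ) =
        algebraMap ℤ_[3] (PadicAlgCl 3) (((GaloisRep.cyclotomicCharacter F' 3 σ) ^ 𝓕.m : ℤ_[3]ˣ) : ℤ_[3]) *
          FramedRep.trace rc σ⁻¹) ∧
    -- (c) potentially unramified at the places of `S'` away from `3`
    (∀ w ∈ S', ((3 : ℕ) : 𝓞 F') ∉ w.asIdeal →
      ∃ U : OpenSubgroup (absoluteGaloisGroup (w.adicCompletion F')),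
        ∀ τ ∈ absInertia (w.adicCompletion F'), τ ∈ U →
          rc (absGaloisRestrict F' (w.adicCompletion F') τ) = 1) ∧
    -- (d) the point is `𝔪_R`-adically continuous and integral (so `ρ_y` is a continuous `ℚ̄₃`-representation),
    --     and `r^c ≡ ρ_y|Γ_{F'}` residually, entrywise in a common integral frame
    (∀ N : ℕ, ∃ M : ℕ, ∀ r ∈ IsLocalRing.maximalIdeal 𝓕.R ^ M, ‖y r‖ ≤ ((3 : ℝ)⁻¹) ^ N) ∧
    (∀ r : 𝓕.R, ‖y r‖ ≤ 1) ∧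
    (∃ g : GL (Fin 3) (PadicAlgCl 3), ∀ (σ : absoluteGaloisGroup F') (i j : Fin 3),
      ‖(g⁻¹ * rc σ * g).val i j‖ ≤ 1 ∧
      ‖(g⁻¹ * rc σ * g).val i j - (pointRep 𝓕 y (absGaloisRestrict K F' σ)).val i j‖ < 1) ∧
    -- (e) same ordinary shape of the same dominant (gaps ≥ 2) labelled weight at every `w ∣ 3`
    (∀ w : HeightOneSpectrum (𝓞 F'), ((3 : ℕ) : 𝓞 F') ∈ w.asIdeal →
      ∀ art : LocalArtinData (w.adicCompletion F'), art.IsCanonical →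
      ∃ wt : LabelledWeight (w.adicCompletion F') (PadicAlgCl 3) 3,
        (∀ τ (i j : Fin 3), i < j → wt τ j + 2 ≤ wt τ i) ∧
        rc.IsOrdinaryOfLabelledWeightAt w art wt ∧
        ∃ (g : GL (Fin 3) (PadicAlgCl 3)) (U : OpenSubgroup (absoluteGaloisGroup (w.adicCompletion F'))),
          (∀ τ : absoluteGaloisGroup (w.adicCompletion F'),
            IsUpper3 (g⁻¹ * pointRep 𝓕 y (absGaloisRestrict K F' (absGaloisRestrict F' (w.adicCompletion F') τ)) *
              g).val) ∧
          ∀ τw ∈ WeilGroup.inertia (w.adicCompletion F'),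
            WeilGroup.toAbsGalois (w.adicCompletion F') τw ∈ U → ∀ i : Fin 3,
              (g⁻¹ * pointRep 𝓕 y (absGaloisRestrict K F'
                  (absGaloisRestrict F' (w.adicCompletion F') (WeilGroup.toAbsGalois (w.adicCompletion F') τw))) *
                g).val i i = (ordinaryWeightUnit wt i (art.artin τw) : PadicAlgCl 3))

/-- The per-point CLASSICALITY clause of char-zero's K1 (`S.stub_definiteHost`), verbatim: `ρ_y` is (the trace of)
a framed representation, absolutely irreducible over `F'`, attached to a regular algebraic cuspidal `P'` on
`GL₃(𝔸_{F'})` unramified outside `S'` with integrally normalised Satake parameters. -/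
def IsClassicalOver (𝓕 : OrdFamily f ι e S₀ ρC)
    (F' : Type) [Field F'] [NumberField F'] [Algebra K F']
    (hcpt' : isCompact_glFiniteIntegralLevel 3 F') (S' : Finset (HeightOneSpectrum (𝓞 F')))
    (y : 𝓕.R →+* PadicAlgCl 3) : Prop :=
  ∃ ρy : FramedGaloisRep K (PadicAlgCl 3) 3,
    (∀ g, FramedRep.trace ρy g = y (𝓕.ρ g).val.trace) ∧
    FramedRep.IsAbsolutelyIrreducible (ρy.restrictField F') ∧
    ∃ P' : CuspidalAutomorphicRepData 3 F' hcpt',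
      P'.1.IsRegularAlgebraic ∧
      ∀ w ∉ S', (∃ α : Multiset ℂ, P'.1.HasSatakeParamAt w α ∧
          ∀ a ∈ α, IsIntegral ℤ ((w.residueCard : ℂ) * a)) ∧
        (((3 : ℕ) : 𝓞 F') ∉ w.asIdeal → IsGaloisCompatibleAt P'.1 ι (ρy.restrictField F') w)

/-! ## 3. Statements of the stubs -/

/-- **K2⁺ — `T.stub_minimalFamily` (THE GALOIS FAMILY; char-zero's lever K2, strengthened to a MINIMAL family with the
Iwasawa weight algebra).**  For generic `f` with `ρ_C` in the main class there is an integral B-ordinary polarized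
`Λ`-adic family `𝓕` through `ρ_C` (`OrdFamily`) of Krull dimension `≥ 4` — the characteristic-zero Greenberg–Wiles
count at `x_C` (Kisin's generic-fibre presentation; `h⁰(ad ρ_C(1)) = 0` in characteristic zero; Allen 2016 §1–2;
Geraghty 2019 §3 flag scheme at the non-distinguished `λ`) — which is moreover MINIMAL away from `3`
(`PotUnramifiedFamily`: purity of `ρ_C` at `v ∈ S₀`, `v ∤ 3`) and whose weight algebra is `𝒪⟦T₁,T₂,T₃⟧` (tree
`WeightAlgebraDim`, p84973).  [Kisin 2003/2008 §2.3; Allen arXiv:1411.7661; Geraghty Math. Ann. 373 §3; CHT §2] -/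
def T.stub_minimalFamily : Prop :=
  ∀ (f : ℤ[X]) (ι : PadicAlgCl 3 ≃+* ℂ) (e : K →+* ℂ) (S₀ : Finset (HeightOneSpectrum (𝓞 K)))
    (ρC : FramedGaloisRep K (PadicAlgCl 3) 3),
    Generic f → PicardInput f ι e S₀ ρC → MainClassPlus f S₀ ρC →
    ∃ 𝓕 : OrdFamily f ι e S₀ ρC, ((4 : ℕ) : WithBot ℕ∞) ≤ ringKrullDim 𝓕.R ∧ PotUnramifiedFamily 𝓕 ∧
      Nonempty (𝓕.Λ ≃+* MvPowerSeries (Fin 3) 𝓕.𝒪)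

/-- **`T.stub_finiteOverWeights` (FINITENESS OVER WEIGHT SPACE).**  Every such family is module-finite over its weight
algebra.  By `𝓕.generated` and `𝓕.weightsGenerate` this is the finiteness over `Λ` of the universal minimal polarized
`Λ`-ordinary deformation ring of the heart over `K`, which is finite over the same ring over `F' = K(√d)` (restriction
to an index-2 subgroup with absolutely irreducible restriction, BLGGT Lemma 1.2.3; `F'_w = K_λ` so the weight algebras
agree), and THAT is `R^{red} = T^{ord}_Λ` for the definite `U(3)_{F'/F'⁺}` at the split prime above `3`: Geraghty's
`Λ`-adic ordinary patching (Math. Ann. 373, §§3–4), whose two image/roots-of-unity inputs at `p = n = 3`, `ζ₃ ∈ F'`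
are EXACTLY Thorne 2017 Prop 2.21 (Taylor–Wiles data killing the dual Selmer group when `ζ_p ∈ F`; the count is
residual, hence weight-independent) and Def 2.20 + GHT Thm 1.7 (extended adequacy of `S₄`) — a port with every
ingredient in print, not a new theorem.  Shortcut if the special-fibre comparison `R^Λ/P_{κ₀} ↠ R^{κ₀}` with nilpotent
kernel is available: Thorne 2017 Thm 4.2 (minimal `R^{red}_S = T` at ONE strongly regular weight `κ₀`, `p = 3`,
`F = F⁺(ζ₃)`) over a soluble CM `L` killing the inertial types, BLGGT Lemma 1.2.3 down to `K`, then formal Nakayama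
along `Λ ↠ Λ/P_{κ₀} = 𝒪` (Matsumura Thm 8.4; `Λ = 𝒪⟦T₁,T₂,T₃⟧` is complete).
[Geraghty Math. Ann. 373 §§3–4; Thorne Math. Z. 285 Prop 2.21, Def 2.20, Thm 4.2; GHT JEMS 19 Thm 1.7;
BLGGT arXiv:1010.2561 Lemma 1.2.3; Matsumura 8.4] -/
def T.stub_finiteOverWeights : Prop :=
  ∀ (f : ℤ[X]) (ι : PadicAlgCl 3 ≃+* ℂ) (e : K →+* ℂ) (S₀ : Finset (HeightOneSpectrum (𝓞 K)))
    (ρC : FramedGaloisRep K (PadicAlgCl 3) 3) (𝓕 : OrdFamily f ι e S₀ ρC),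
    Generic f → PicardInput f ι e S₀ ρC → MainClassPlus f S₀ ρC →
    ((4 : ℕ) : WithBot ℕ∞) ≤ ringKrullDim 𝓕.R → PotUnramifiedFamily 𝓕 →
    Nonempty (𝓕.Λ ≃+* MvPowerSeries (Fin 3) 𝓕.𝒪) →
    Module.Finite 𝓕.Λ 𝓕.R

/-- **`T.stub_companions` (HIDA THEORY OVER `F'`: ordinary automorphic companions of every arithmetic weight near
`x_C`).**  For such a family there are a Galois CM quadratic extension `F'/K` over which the heart keeps its
image (intended `F' = K(√d) = ℚ(ω, √d)`, `d > 0`, `d ≡ 6 mod 9`, so `3` splits in `F'/ℚ(√d)` with `F'_w = K_λ`), a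
level `S'` above `S₀`, a finite `E/ℚ₃` and a set `D` of `E`-integral weights `κ : Λ → ℚ̄₃` ACCUMULATING UNIFORMLY at
the weight of the Picard point, such that every point `y` of `𝓕.R` over `D` (automatically `𝔪_R`-adically continuous and integral, by finiteness
over `Λ` and continuity of `κ` — Artin–Rees) has an ordinary automorphic companion over `F'` (`HasOrdinaryCompanion`).
Intended proof: `D` = strongly dominant arithmetic weights in the nebentype
class of `x_C` (dense at `w(x_C)`, whose middle character is locally algebraic: `ρ_C` is de Rham); companions = the
weight-`κ` members of the ordinary Hida family on the definite `U(3)_{F'/F'⁺}` through `BC_{F'/K}` of the free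
seed (`BC_{K/ℚ}(Sym² g) ⊗ ψ` for the `3`-ordinary weight-2 member `g` of the octahedral Hida family, resp. the CM
induction in the totally real branch), transferred to `GL₃/F'` by Labesse, with Galois representations ordinary of
weight `κ` by local–global compatibility at `w ∣ 3` (Caraiani; BLGGT §2.1 "`ι`-ordinary ⇒ ordinary").
[Geraghty Math. Ann. 373 §2; Labesse 2011; route items ResidualAutomorphyOdd/Even; BLGGT §2.1] -/
def T.stub_companions : Prop :=
  ∀ (f : ℤ[X]) (ι : PadicAlgCl 3 ≃+* ℂ) (e : K →+* ℂ) (S₀ : Finset (HeightOneSpectrum (𝓞 K)))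
    (ρC : FramedGaloisRep K (PadicAlgCl 3) 3) (𝓕 : OrdFamily f ι e S₀ ρC),
    Generic f → PicardInput f ι e S₀ ρC → MainClassPlus f S₀ ρC →
    ((4 : ℕ) : WithBot ℕ∞) ≤ ringKrullDim 𝓕.R → PotUnramifiedFamily 𝓕 → Module.Finite 𝓕.Λ 𝓕.R →
    ∃ (F' : Type) (_ : Field F') (_ : NumberField F') (_ : Algebra K F') (_ : IsGalois ℚ F')
      (hcpt' : isCompact_glFiniteIntegralLevel 3 F') (S' : Finset (HeightOneSpectrum (𝓞 F')))
      (D : Set (𝓕.Λ →+* PadicAlgCl 3)) (E : IntermediateField ℚ_[3] (PadicAlgCl 3)),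
      Module.finrank K F' = 2 ∧ NumberField.IsCMField F' ∧
      ((rbar f 𝓕.B).comp (absGaloisRestrict K F').toMonoidHom).range = (rbar f 𝓕.B).range ∧
      FiniteDimensional ℚ_[3] E ∧
      (∀ w : HeightOneSpectrum (𝓞 F'), w.under (𝓞 K) ∈ S₀ → w ∈ S') ∧
      (∀ κ ∈ D, ∀ a : 𝓕.Λ, κ a ∈ E ∧ ‖κ a‖ ≤ 1) ∧
      (∀ M : ℕ, ∃ κ ∈ D, ∀ a : 𝓕.Λ,
        ‖κ a - 𝓕.j (𝓕.x (algebraMap 𝓕.Λ 𝓕.R a))‖ ≤ ((3 : ℝ)⁻¹) ^ M) ∧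
      ∀ y : 𝓕.R →+* PadicAlgCl 3, y.comp (algebraMap 𝓕.Λ 𝓕.R) ∈ D →
        HasOrdinaryCompanion 𝓕 F' hcpt' S' y

/-- **`T.stub_thorneLift` (POINTWISE MINIMAL AUTOMORPHY LIFTING — Thorne 2017 Thm 5.1 at `p = n = 3` over a CM field
containing `ζ₃`, with the extended adequacy of `S₄` from GHT 2017 Thm 1.7).**  Let `𝓕` be a minimal family through
`ρ_C` in the main class, `F'/K` a Galois CM quadratic extension over which the heart keeps its (`S₄`) image, `S'` a
level above `S₀`.  Then every point `y` of `𝓕.R` admitting an ordinary automorphic companion over `F'` is CLASSICAL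
over `F'` (`IsClassicalOver`: the per-point clause of char-zero's K1).  Intended proof: `ρ_y := y ∘ 𝓕.ρ` is
continuous, polarized (`𝓕.polarized`), unramified outside `S₀`, potentially unramified on `S₀ ∖ {λ}`
(`PotUnramifiedFamily`), Borel at `λ` with the companion's dominant gap-`≥ 2` weight (so potentially crystalline and
potentially diagonalizable, BLGGT Lemma 1.4.3(1) and §1.4 "cr-ordinary"), residually the `S₄` heart (adequate over
`F'(ζ₃) = F'`: GHT Thm 1.7 / `toy/adequacy_s4_f3.py`); twist `ρ_y|Γ_{F'}` and the companion to the exact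
normalisation `ρ^c ≅ ρ^∨ε^{-2}` by one algebraic Hecke character of `F'`; pass to a soluble CM `L/F'`, Galois over
`ℚ`, linearly disjoint from `K(f, ζ₉)`, in which both finite inertial images at `S' ∖ {3}` die (CHT Lemma 4.1.2),
so that hypothesis (iv)(b) of Thorne's Thm 5.1 holds at every finite place of `L` (automatic at unramified places;
at `u ∣ 3` both sides are sums of the same crystalline characters up to `∼`); Thm 5.1 gives automorphy over `L`,
BLGGT Lemma 2.2.2 descends it to `F'`; compatibility at unramified `w ∤ 3` and integrality of `N w · Satake` are
part of `r_ι` (HLTT / Caraiani / Shin).  [Thorne Math. Z. 285 (2017) Thm 5.1, Def 2.20, Prop 2.21, Def 3.6;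
GHT JEMS 19 Thm 1.7; BLGGT arXiv:1010.2561 Lemma 1.4.3, Lemma 2.2.2, §1.4; CHT 2008 Lemma 4.1.2] -/
def T.stub_thorneLift : Prop :=
  ∀ (f : ℤ[X]) (ι : PadicAlgCl 3 ≃+* ℂ) (e : K →+* ℂ) (S₀ : Finset (HeightOneSpectrum (𝓞 K)))
    (ρC : FramedGaloisRep K (PadicAlgCl 3) 3) (𝓕 : OrdFamily f ι e S₀ ρC),
    Generic f → PicardInput f ι e S₀ ρC → MainClassPlus f S₀ ρC → PotUnramifiedFamily 𝓕 →
    ∀ (F' : Type) [Field F'] [NumberField F'] [Algebra K F'] [IsGalois ℚ F']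
      (hcpt' : isCompact_glFiniteIntegralLevel 3 F') (S' : Finset (HeightOneSpectrum (𝓞 F'))),
      Module.finrank K F' = 2 → NumberField.IsCMField F' →
      ((rbar f 𝓕.B).comp (absGaloisRestrict K F').toMonoidHom).range = (rbar f 𝓕.B).range →
      (∀ w : HeightOneSpectrum (𝓞 F'), w.under (𝓞 K) ∈ S₀ → w ∈ S') →
    ∀ y : 𝓕.R →+* PadicAlgCl 3, HasOrdinaryCompanion 𝓕 F' hcpt' S' y → IsClassicalOver 𝓕 F' hcpt' S' y

/-- char-zero's K1 on the enlarged scope (the statement the composition consumes; PROVED below from stubs 2–4). -/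
def T.stub_definiteHostPlus : Prop :=
  ∀ (f : ℤ[X]) (ι : PadicAlgCl 3 ≃+* ℂ) (e : K →+* ℂ) (S₀ : Finset (HeightOneSpectrum (𝓞 K)))
    (ρC : FramedGaloisRep K (PadicAlgCl 3) 3) (𝓕 : OrdFamily f ι e S₀ ρC),
    Generic f → PicardInput f ι e S₀ ρC → MainClassPlus f S₀ ρC →
    ((4 : ℕ) : WithBot ℕ∞) ≤ ringKrullDim 𝓕.R → PotUnramifiedFamily 𝓕 →
    Nonempty (𝓕.Λ ≃+* MvPowerSeries (Fin 3) 𝓕.𝒪) →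
    Module.Finite 𝓕.Λ 𝓕.R ∧
    ∃ (F' : Type) (_ : Field F') (_ : NumberField F') (_ : Algebra K F')
      (hcpt' : isCompact_glFiniteIntegralLevel 3 F') (S' : Finset (HeightOneSpectrum (𝓞 F')))
      (D : Set (𝓕.Λ →+* PadicAlgCl 3)) (E : IntermediateField ℚ_[3] (PadicAlgCl 3)),
      Module.finrank K F' = 2 ∧ FiniteDimensional ℚ_[3] E ∧
      (∀ w : HeightOneSpectrum (𝓞 F'), w.under (𝓞 K) ∈ S₀ → w ∈ S') ∧
      (∀ κ ∈ D, ∀ a : 𝓕.Λ, κ a ∈ E ∧ ‖κ a‖ ≤ 1) ∧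
      (∀ M : ℕ, ∃ κ ∈ D, ∀ a : 𝓕.Λ,
        ‖κ a - 𝓕.j (𝓕.x (algebraMap 𝓕.Λ 𝓕.R a))‖ ≤ ((3 : ℝ)⁻¹) ^ M) ∧
      (∀ y : 𝓕.R →+* PadicAlgCl 3, y.comp (algebraMap 𝓕.Λ 𝓕.R) ∈ D → IsClassicalOver 𝓕 F' hcpt' S' y)

/-- **`T.stub_remainderPlus` — NOT a lemma of the line: the conceded complement.**  The crux verbatim for generic `f`
with `ρ_C` OUTSIDE the main class of this line: not μ-ordinary at `3` (BBW types (a), (c): λ-supersingular —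
where even reciprocity + Zariski density does not predict the typed conclusion for supercuspidal inertial type,
Disproof F8/F12c — or (d), (e)), heart image `A₄` (not adequate: `V₄` normal abelian of index `3`, GHT Thm 1.7;
`H¹(A₄, 𝔽₃) ≠ 0`), or genuinely bad (toric) reduction at some `v ∤ 3`.  To be promoted to the planned split of the
crux (route two-layer plan (1), kill criterion (4)); never claimed inside this line. -/
def T.stub_remainderPlus : Prop :=
  ∀ (f : ℤ[X]) (hcpt : isCompact_glFiniteIntegralLevel 3 (CyclotomicField 3 ℚ))
    (ι : PadicAlgCl 3 ≃+* ℂ) (e : K →+* ℂ) (S₀ : Finset (HeightOneSpectrum (𝓞 K)))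
    (ρC : FramedGaloisRep K (PadicAlgCl 3) 3),
    Generic f → PicardInput f ι e S₀ ρC → ¬ MainClassPlus f S₀ ρC → ResidualHyp f hcpt → LimitConcl f hcpt

/-- The two Literature debts of the landed conditional stubs of char-zero-dominance (its `S.stub_picardFact`: the
`λ`-adic representation of a Picard curve; its `S.stub_descentFacts`: Arthur–Clozel lifting/descent, infinity types,
lang.S27), bundled. -/
def T.stub_facts : Prop :=
  S.stub_picardFact ∧ S.stub_descentFacts

/-! ## 4. Definitional handle (registered, so that this vocabulary file lands `--supports` the crux) -/

/-- The scope of the line unfolds, by definition, to char-zero's `MainClass` and potential unramifiedness away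
from `3` (definitional lemma; the registered handle through which this Defs file lands). -/
theorem mainClassPlus_iff : ∀ (f : ℤ[X]) (S₀ : Finset (HeightOneSpectrum (𝓞 K))) (ρC : FramedGaloisRep K (PadicAlgCl 3) 3), MainClassPlus f S₀ ρC ↔ (MainClass f ρC ∧ PotUnramifiedAway S₀ ρC) :=
  fun _ _ _ => Iff.rfl

end

end Summit.Langlands.Langlands.Cruxes.MuOrdinaryFamilyRT.ThorneMinimalLift
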